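import Summits.HodgeConjecture.HodgeConjecture.Theorems.K2LiuDoublingSectionIntegrableReduction   -- ★ helper 1 (p854858)
import Mathlib.Topology.Order.Compact                                                            -- `IsCompact.exists_isMinOn`
import HarnessLib

/-!
# Crux `HLiu418`, Track B road `K2_Liu`, unit U5 «DOUBLING ZETA», file #14a ∕ organ (IV) — helper 2:
# all continuous `(P_Δ, |det_Δ|^{1∕2})`-heights are comparable; the doubling decay transfers between them; #14a from (I) + (IV) for ONE height

Cell `hodgecm-mathlib`, crux item hLiu418 = `stmt-HodgeConjecture-24832`, route of record `HCCMUnconditional`; squad K2 ∕ K2Liu,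
LEAD F0P6-plan (g10) RULING (Q14a) 21:20:27Z («organ (IV) = socket #16 `sig_K2LiuDoublingHeightDecay` in the ∀Φ shape; ONE height Φ
shared with K2Liu-p09»), prover K2Liu-p04 (g0).  THEOREMS ONLY (no `def`, no instance, no notation, no named-fact hypothesis, no `sorry`);
lane `--supports stmt-HodgeConjecture-24832 --as helper` (count-neutral).  Sequel of ★ `Theorems/K2LiuDoublingSectionIntegrableReduction`.

WHY.  Socket #16 quantifies over EVERY continuous positive `Φ : H(𝔸) → ℝ` of type `(P_Δ, modDelta)` (`Φ(p x) = modDelta(p) Φ(x)`), while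
any proof of the doubling decay computes with ONE explicit height (the Iwasawa-choice height of K2Liu-p09's plan, or a Plücker height).
Given the Iwasawa decomposition (I) `H(𝔸) = P_Δ(𝔸) · K` with `K` compact (★ `K2LiuSiegelDoubledIwasawaCompact`), the quotient of two such
heights is a continuous positive function of `k ∈ K` alone, hence bounded above and below: all such heights are EQUIVALENT, so the decay
(IV) for one of them gives (IV) for all, and a continuous height is automatically bounded below on `K` (the `c` of helper 1).

* §1 `exists_pos_le_on_compact` — a continuous positive function has a positive lower bound on a compact set;
  `exists_pos_forall_le_mul` — **comparison**: under (I), for continuous positive `Φ₁, Φ₂` of type `(P_Δ, modDelta)` there is `C > 0`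
  with `Φ₁ ≤ C · Φ₂` on all of `H(𝔸)` ([Garrett2018, §2.2: heights attached to different data are comparable]; [GelbartPiatetskishapiroRallis1987, Part A §1]);
* §2 `integrable_rpow_comp_iotaLeft_of_le` — **transfer of the doubling decay**: `Φ₁ ≤ C Φ₂`, `τ ≥ 0`, `Φ₂(ι(·,1))^τ ∈ L¹(ν)` ⇒
  `Φ₁(ι(·,1))^τ ∈ L¹(ν)`; hence `decay_transfer` — (IV) above a threshold for ONE continuous height implies it for EVERY continuous height;
* §3 **`exists_threshold_integrable_comp_iotaLeft_of_continuous_height`** — (I) ∧ «(IV) for one CONTINUOUS height» ⇒ the exact shape of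
  socket #14a (helper 1 §4 with the lower bound `c` now supplied by §1), for an arbitrary Hecke character.

HONEST LABEL.  Count-neutral helper; organ (IV) itself (the XL analytic engine: an explicit height, its decay `Φ(ι(g,1)) ≲ ‖g‖^{-α}` along the
doubling embedding, and `∫_{U(V)(𝔸)} ‖g‖^{-β} dν < ∞`) is NOT proved here.  `HC_CM` is proved only modulo the 7 printed citations (2 remaining
named inputs: hLiu418 = `stmt-HodgeConjecture-24832`, h413 = `stmt-HodgeConjecture-24833`) until rung 0 closes.

## References
* [Garrett2018] P. Garrett, *Modern Analysis of Automorphic Forms by Example* (2018), §2.2 (heights; comparability), §3.10.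
* [GelbartPiatetskishapiroRallis1987] I. Piatetski-Shapiro, S. Rallis, *L-functions for the classical groups* (Part A of LNM 1254), §1.
* [Liu2021] Y. Liu, *Fourier–Jacobi cycles and arithmetic relative trace formula*, App. B, Lem. B.10 (2) p. 102.
-/

set_option autoImplicit false
-- the mandated namespace repeats the single-problem summit's segment (`HodgeConjecture.HodgeConjecture`)
set_option linter.dupNamespace false

noncomputable section

open scoped Matrix
open NumberField IsDedekindDomain MeasureTheory

namespace Summit.HodgeConjecture.HodgeConjecture.Cruxes.HLiu418.K2LiuDoublingHeightComparison

open Literature.NumberTheory.Automorphic Literature.NumberTheory.GaloisRepresentations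
open Literature.NumberTheory.GelbartRogawski1991 Literature.NumberTheory.GelbartRogawski1991.GRConstruction
open Literature.NumberTheory.K2Lit.SiegelDoubled
open Summit.HodgeConjecture.HodgeConjecture.Cruxes.HLiu418.K2LiuDoublingSectionIntegrableReduction

variable (L : Type) [Field L] [NumberField L] [IsCMField L]
variable {N M n : ℕ} (e : Fin N × Fin M ≃ Fin n)
  (dV : Fin N → L) (hdV : ∀ i, IsCMField.complexConj L (dV i) = dV i)
  (dW : Fin M → L) (hdW : ∀ i, IsCMField.complexConj L (dW i) = dW i)

/-! ## §1 Lower bounds on compacta; comparison of heights of type `(P_Δ, modDelta)` -/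

/-- A continuous positive real function has a POSITIVE lower bound on a compact set (its minimum, or `1` if the set is empty).
[folklore] -/
theorem exists_pos_le_on_compact {X : Type*} [TopologicalSpace X] {K : Set X} (hK : IsCompact K) {Φ : X → ℝ}
    (hΦc : Continuous Φ) (hΦpos : ∀ x, 0 < Φ x) : ∃ c : ℝ, 0 < c ∧ ∀ k ∈ K, c ≤ Φ k := by
  rcases K.eq_empty_or_nonempty with hKe | hKne
  · exact ⟨1, one_pos, fun k hk => by simp [hKe] at hk⟩
  · obtain ⟨k₀, hk₀, hmin⟩ := hK.exists_isMinOn hKne hΦc.continuousOn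
    exact ⟨Φ k₀, hΦpos k₀, fun k hk => hmin hk⟩

/-- **Comparison of heights.**  Under the Iwasawa decomposition (I) `H(𝔸) = P_Δ(𝔸) · K` (`K` compact), two CONTINUOUS functions
`Φ₁, Φ₂ : H(𝔸) → ℝ` of type `(P_Δ, modDelta)`, `Φ₂ > 0`, satisfy `Φ₁ ≤ C · Φ₂` for some `C > 0` (the ratio `Φ₁ ∕ Φ₂` is a function of `k ∈ K`).
[cite: Garrett2018, §2.2] [cite: GelbartPiatetskishapiroRallis1987, Part A §1] -/
theorem exists_pos_forall_le_mul {K : Set (HA L e dV hdV dW hdW)} (hK : IsCompact K)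
    (hPK : ∀ x : HA L e dV hdV dW hdW, ∃ p k : HA L e dV hdV dW hdW,
      IsSiegelDelta L e dV hdV dW hdW p ∧ k ∈ K ∧ x = p * k)
    {Φ₁ Φ₂ : HA L e dV hdV dW hdW → ℝ} (h₁c : Continuous Φ₁) (h₂c : Continuous Φ₂) (h₂pos : ∀ x, 0 < Φ₂ x)
    (h₁ : ∀ p x, IsSiegelDelta L e dV hdV dW hdW p → Φ₁ (p * x) = modDelta L e dV hdV dW hdW p * Φ₁ x)
    (h₂ : ∀ p x, IsSiegelDelta L e dV hdV dW hdW p → Φ₂ (p * x) = modDelta L e dV hdV dW hdW p * Φ₂ x) :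
    ∃ C : ℝ, 0 < C ∧ ∀ x, Φ₁ x ≤ C * Φ₂ x := by
  -- the ratio is continuous on the compact `K`, hence bounded there
  have hrc : Continuous fun x => Φ₁ x / Φ₂ x := h₁c.div h₂c fun x => (h₂pos x).ne'
  obtain ⟨B, hB⟩ := hK.exists_bound_of_continuousOn hrc.continuousOn
  refine ⟨max B 1, lt_of_lt_of_le one_pos (le_max_right B 1), fun x => ?_⟩
  obtain ⟨p, k, hp, hk, rfl⟩ := hPK x
  have hBk : |Φ₁ k / Φ₂ k| ≤ B := by
    have h := hB k hk
    rwa [Real.norm_eq_abs] at h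
  have hratio : Φ₁ k / Φ₂ k ≤ max B 1 := le_trans (le_trans (le_abs_self _) hBk) (le_max_left B 1)
  have hk' : Φ₁ k ≤ max B 1 * Φ₂ k := by rwa [div_le_iff₀ (h₂pos k)] at hratio
  rw [h₁ p k hp, h₂ p k hp]
  calc modDelta L e dV hdV dW hdW p * Φ₁ k ≤ modDelta L e dV hdV dW hdW p * (max B 1 * Φ₂ k) :=
        mul_le_mul_of_nonneg_left hk' (modDelta_pos L e dV hdV dW hdW p).le
    _ = max B 1 * (modDelta L e dV hdV dW hdW p * Φ₂ k) := by ring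

/-! ## §2 Transfer of the doubling decay between comparable heights -/

/-- **Transfer of integrability along `ι(·, 1)`**: if `0 < Φ₁ ≤ C Φ₂` pointwise, `Φ₁` continuous, `τ ≥ 0` and `g ↦ Φ₂(ι(g,1))^τ` is
`ν`-integrable on `U(V)(𝔸)`, then so is `g ↦ Φ₁(ι(g,1))^τ` (domination by `C^τ · Φ₂(ι(g,1))^τ`).
[cite: GelbartPiatetskishapiroRallis1987, Part A §1] [cite: Liu2021, Lem. B.10 (2) p. 102] -/
theorem integrable_rpow_comp_iotaLeft_of_le {Φ₁ Φ₂ : HA L e dV hdV dW hdW → ℝ} (h₁c : Continuous Φ₁)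
    (h₁pos : ∀ x, 0 < Φ₁ x) {C : ℝ} (hC : 0 < C) (hle : ∀ x, Φ₁ x ≤ C * Φ₂ x) {τ : ℝ} (hτ : 0 ≤ τ)
    [MeasurableSpace (UnitaryGroup.adelic (Fp L) L (IsCMField.complexConj L) N (Matrix.diagonal dV))]
    [BorelSpace (UnitaryGroup.adelic (Fp L) L (IsCMField.complexConj L) N (Matrix.diagonal dV))]
    (ν : Measure (UnitaryGroup.adelic (Fp L) L (IsCMField.complexConj L) N (Matrix.diagonal dV)))
    (h₂ : Integrable (fun g => Φ₂ (iotaLeft L e dV hdV dW hdW g) ^ τ) ν) :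
    Integrable (fun g => Φ₁ (iotaLeft L e dV hdV dW hdW g) ^ τ) ν := by
  have hmeas : AEStronglyMeasurable (fun g => Φ₁ (iotaLeft L e dV hdV dW hdW g) ^ τ) ν :=
    ((h₁c.comp (continuous_iotaLeft L e dV hdV dW hdW)).rpow_const fun _ => Or.inr hτ).aestronglyMeasurable
  refine Integrable.mono' (h₂.const_mul (C ^ τ)) hmeas (Filter.Eventually.of_forall fun g => ?_)
  have h0 : 0 ≤ Φ₁ (iotaLeft L e dV hdV dW hdW g) := (h₁pos _).le
  have h2 : 0 ≤ Φ₂ (iotaLeft L e dV hdV dW hdW g) :=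
    ((mul_pos_iff_of_pos_left hC).1 (lt_of_lt_of_le (h₁pos _) (hle _))).le
  rw [Real.norm_eq_abs, abs_of_nonneg (Real.rpow_nonneg h0 τ)]
  calc Φ₁ (iotaLeft L e dV hdV dW hdW g) ^ τ ≤ (C * Φ₂ (iotaLeft L e dV hdV dW hdW g)) ^ τ :=
        Real.rpow_le_rpow h0 (hle _) hτ
    _ = C ^ τ * Φ₂ (iotaLeft L e dV hdV dW hdW g) ^ τ := Real.mul_rpow hC.le h2

/-- **(IV) for ONE continuous height gives (IV) for EVERY continuous height** (under (I)): if `Φ₂` is a continuous positive height of type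
`(P_Δ, modDelta)` whose powers `≥ τ₁` decay integrably along `ι(·,1)` for every Haar `ν`, then the same holds (with threshold `max τ₁ 0`) for
every other continuous positive height `Φ₁` of that type. [cite: Garrett2018, §2.2] [cite: GelbartPiatetskishapiroRallis1987, Part A §1] -/
theorem decay_transfer {K : Set (HA L e dV hdV dW hdW)} (hK : IsCompact K)
    (hPK : ∀ x : HA L e dV hdV dW hdW, ∃ p k : HA L e dV hdV dW hdW,
      IsSiegelDelta L e dV hdV dW hdW p ∧ k ∈ K ∧ x = p * k)
    {Φ₁ Φ₂ : HA L e dV hdV dW hdW → ℝ} (h₁c : Continuous Φ₁) (h₂c : Continuous Φ₂)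
    (h₁pos : ∀ x, 0 < Φ₁ x) (h₂pos : ∀ x, 0 < Φ₂ x)
    (h₁ : ∀ p x, IsSiegelDelta L e dV hdV dW hdW p → Φ₁ (p * x) = modDelta L e dV hdV dW hdW p * Φ₁ x)
    (h₂ : ∀ p x, IsSiegelDelta L e dV hdV dW hdW p → Φ₂ (p * x) = modDelta L e dV hdV dW hdW p * Φ₂ x) {τ₁ : ℝ}
    (hdecay : ∀ τ : ℝ, τ₁ ≤ τ →
      ∀ [MeasurableSpace (UnitaryGroup.adelic (Fp L) L (IsCMField.complexConj L) N (Matrix.diagonal dV))]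
        [BorelSpace (UnitaryGroup.adelic (Fp L) L (IsCMField.complexConj L) N (Matrix.diagonal dV))]
        (ν : Measure (UnitaryGroup.adelic (Fp L) L (IsCMField.complexConj L) N (Matrix.diagonal dV)))
        [ν.IsHaarMeasure],
        Integrable (fun g => Φ₂ (iotaLeft L e dV hdV dW hdW g) ^ τ) ν) :
    ∀ τ : ℝ, max τ₁ 0 ≤ τ →
      ∀ [MeasurableSpace (UnitaryGroup.adelic (Fp L) L (IsCMField.complexConj L) N (Matrix.diagonal dV))]
        [BorelSpace (UnitaryGroup.adelic (Fp L) L (IsCMField.complexConj L) N (Matrix.diagonal dV))]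
        (ν : Measure (UnitaryGroup.adelic (Fp L) L (IsCMField.complexConj L) N (Matrix.diagonal dV)))
        [ν.IsHaarMeasure],
        Integrable (fun g => Φ₁ (iotaLeft L e dV hdV dW hdW g) ^ τ) ν := by
  intro τ hτ _ _ ν _
  obtain ⟨C, hC, hle⟩ := exists_pos_forall_le_mul L e dV hdV dW hdW hK hPK h₁c h₂c h₂pos h₁ h₂
  exact integrable_rpow_comp_iotaLeft_of_le L e dV hdV dW hdW h₁c h₁pos hC hle (le_trans (le_max_right τ₁ 0) hτ) ν
    (hdecay τ (le_trans (le_max_left τ₁ 0) hτ) ν)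

/-! ## §3 Socket #14a's shape from (I) and the decay of ONE continuous height -/

/-- **«(I) ∧ (IV) for one CONTINUOUS height ⇒ the SHAPE of socket #14a»** (helper 1 §4 with the lower bound on `K` supplied by §1): given the
Iwasawa decomposition `H(𝔸) = P_Δ(𝔸) · K` (`K` compact) and a continuous positive height `Φ` of type `(P_Δ, modDelta)` whose powers `≥ τ₁`
are integrable along `g ↦ ι(g, 1)` for every Haar `ν` on `U(V)(𝔸)`, every Hecke character `χ` admits `σ₀` such that for `Re s > σ₀` every
continuous Siegel section of `I(s, χ)` is `ν`-integrable along `g ↦ ι(g, 1)` — token for token the conclusion of `sig_K2LiuDoublingSectionIntegrable`.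
[cite: Liu2021, Lem. B.10 (2) p. 102] [cite: GelbartPiatetskishapiroRallis1987, Part A §1] -/
theorem exists_threshold_integrable_comp_iotaLeft_of_continuous_height (χ : HeckeCharacter L)
    {K : Set (HA L e dV hdV dW hdW)} (hK : IsCompact K)
    (hPK : ∀ x : HA L e dV hdV dW hdW, ∃ p k : HA L e dV hdV dW hdW,
      IsSiegelDelta L e dV hdV dW hdW p ∧ k ∈ K ∧ x = p * k)
    {Φ : HA L e dV hdV dW hdW → ℝ} (hΦc : Continuous Φ) (hΦpos : ∀ x, 0 < Φ x)
    (hΦ : ∀ p x, IsSiegelDelta L e dV hdV dW hdW p → Φ (p * x) = modDelta L e dV hdV dW hdW p * Φ x) {τ₁ : ℝ}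
    (hdecay : ∀ τ : ℝ, τ₁ ≤ τ →
      ∀ [MeasurableSpace (UnitaryGroup.adelic (Fp L) L (IsCMField.complexConj L) N (Matrix.diagonal dV))]
        [BorelSpace (UnitaryGroup.adelic (Fp L) L (IsCMField.complexConj L) N (Matrix.diagonal dV))]
        (ν : Measure (UnitaryGroup.adelic (Fp L) L (IsCMField.complexConj L) N (Matrix.diagonal dV)))
        [ν.IsHaarMeasure],
        Integrable (fun g => Φ (iotaLeft L e dV hdV dW hdW g) ^ τ) ν) :
    ∃ σ₀ : ℝ, ∀ (s : ℂ), σ₀ < s.re →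
      ∀ (f : HA L e dV hdV dW hdW → ℂ), IsSiegelDeltaSection L e dV hdV dW hdW χ s f → Continuous f →
        ∀ [MeasurableSpace (UnitaryGroup.adelic (Fp L) L (IsCMField.complexConj L) N (Matrix.diagonal dV))]
          [BorelSpace (UnitaryGroup.adelic (Fp L) L (IsCMField.complexConj L) N (Matrix.diagonal dV))]
          (ν : Measure (UnitaryGroup.adelic (Fp L) L (IsCMField.complexConj L) N (Matrix.diagonal dV)))
          [ν.IsHaarMeasure],
          Integrable (fun g => f (iotaLeft L e dV hdV dW hdW g)) ν := by
  obtain ⟨c, hc, hcK⟩ := exists_pos_le_on_compact hK hΦc hΦpos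
  exact exists_threshold_integrable_comp_iotaLeft L e dV hdV dW hdW χ hK hPK hΦpos hΦ hc hcK hdecay

end Summit.HodgeConjecture.HodgeConjecture.Cruxes.HLiu418.K2LiuDoublingHeightComparison

end
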